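import Literature.Analysis.FluidPDE.NSRegFourierDuhamel
import HarnessLib

/-!
# The `L²` Picard scheme for the Leray-regularised Navier–Stokes system on the Fourier side

Third file of the Fourier-side construction of the global regular solution of the
Leray-regularised Navier–Stokes system (discharge of
`Literature.Analysis.FluidPDE.leray_regularised_wellposed`; previous files `NSRegFourierBilinear`,
`NSRegFourierDuhamel`). For a heat rate `c = 4π²ν > 0`, a mollifier multiplier `m`
(`IsMollifierSymbol`), a weight `K` and a measurable Fourier datum `a` with `a ∈ L²` and
`wfun K a ∈ L²` (but no pointwise bound: `a = m · û₀`, `u₀ ∈ L²`), the mild form of the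
regularised system is the fixed-point equation

  `v(t, ξ) = e^{-c‖ξ‖²τ} a(ξ) − D(v, v)(t, ξ)`,  `τ = clamp T t`,

`D` the regularised Duhamel term of `NSRegFourierDuhamel` (Leray 1934, §26: the regularised system
is solved "par approximations successives" exactly as the Navier–Stokes system in §19;
Ożański–Pooley 2018, Thm. 6.33). We run the Picard iteration `v₀ = e^{-c‖ξ‖²τ} a`,
`v_{n+1} = e^{-c‖ξ‖²τ} a − D(v_n, v_n)` **pointwise in `(t, ξ)`**, with all sizes measured in the
two norms `sup_t ‖v(t)‖_{L²}` and `sup_t ‖wfun K v(t)‖_{L²}`: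

* `RPicardHyp c m K T A AK a` — the hypotheses, including the **contraction condition**
  `2 ρ ≤ 1`, `ρ = C₀(c) T^{1/2} κ_K 4A` (`C₀ = 4π(2c)^{-1/2}`, `κ_K = card² ‖wfun K m‖_{L²}`), which
  involves the datum through `A ≥ ‖a‖_{L²}` ONLY (two-norm bookkeeping: the weighted size `AK`
  of the datum is propagated but does not restrict the time `T`); `rpicardTime` realises it;
* every iterate is jointly measurable, continuous in `t` at each frequency, and obeys
  `‖v_n(t)‖_{L²} ≤ 2A`, `‖wfun K v_n(t)‖_{L²} ≤ 2AK` (`RPicardHyp.iter_inv`);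
* the differences decay geometrically in both norms,
  `‖wfun J (v_{n+1} − v_n)(t)‖_{L²} ≤ ρ^{n+1} A_J` (`RPicardHyp.eLpNorm_iter_sub_le`), and
  **pointwise**: `(1+‖ξ‖)^K ‖v_{n+1}(t,ξ) − v_n(t,ξ)‖ ≤ C ρⁿ` (`RPicardHyp.weight_mul_enorm_iter_sub_le`)
  — the Cauchy–Schwarz bound of a convolution of two `L²` functions makes `L²`-small differences
  pointwise small;
* hence the pointwise limit `rpicardLimit` exists, is jointly measurable, continuous in `t` at each
  frequency, obeys the same `L²` bounds (Fatou), is the `L²` limit of the iterates, and is a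
  **fixed point of the Duhamel map at every `(t, ξ)`** (`RPicardHyp.fixed`), with `v(0) = a`.

* `SliceBound.sum_mul_duhamelR`, `SliceBound.duhamelR_conj_symm` and `RPicardHyp.sum_mul_limit`,
  `RPicardHyp.limit_conj_symm` — transversality `∑ₗ ξₗ vₗ = 0` and conjugation symmetry
  `v(t,-ξ) = conj v(t,ξ)` are preserved (the datum being transversal / conjugation symmetric, `m`
  real and even);
* `rpicardTime c m K A` — an explicit admissible time, `RPicardHyp.of_rpicardTime`;
* `RPicardHyp.tendsto_eLpNorm_limit_sub` — for `2K > card ι` the limit is continuous in time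
  into `L²` (domination `‖v(t,ξ)‖ ≤ ‖a ξ‖ + C (1+‖ξ‖)^{-K}`, `RPicardHyp.exists_enorm_limit_le`).

The energy identity, uniqueness and the continuation to all times are in the next files.

## References

* J. Leray, *Sur le mouvement d'un liquide visqueux emplissant l'espace*, Acta Math. 63 (1934),
  §19 (successive approximations), Ch. V §26 (the regularised system). [Leray1934]
* W. S. Ożański, B. C. Pooley, LMS Lecture Note Ser. 452 (CUP 2018), Thm. 6.33, (6.77)–(6.81).
  [OzanskiPooley2018]
* P. G. Lemarié-Rieusset, *The Navier–Stokes problem in the 21st century* (2016), §8.5.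
-/

noncomputable section

open MeasureTheory Real Set Filter Topology Function Complex intervalIntegral
open scoped ENNReal NNReal ComplexConjugate

namespace Literature.Analysis.FluidPDE.FourierNS

variable {ι : Type*} [Fintype ι] [DecidableEq ι]

/-! ### The constants of the scheme -/

omit [Fintype ι] [DecidableEq ι] in
/-- `C₀(c) = 4π (2c)^{-1/2}`, the constant of the Duhamel estimates. [folklore] -/
def C₀ (c : ℝ) : ℝ≥0∞ := ENNReal.ofReal (4 * π) * ENNReal.ofReal (1 / (2 * c)) ^ (1 / 2 : ℝ)

omit [Fintype ι] [DecidableEq ι] in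
/-- `C₀(c) < ∞`. [folklore] -/
theorem C₀_ne_top (c : ℝ) : C₀ c ≠ ∞ :=
  ENNReal.mul_ne_top ENNReal.ofReal_ne_top (ENNReal.rpow_ne_top_of_nonneg (by norm_num) ENNReal.ofReal_ne_top)

omit [DecidableEq ι] in
/-- `κ_K(m) = card² ‖wfun K m‖_{L²}`, the constant of the weighted `L²` convolution bound. [folklore] -/
def kap (m : (EuclideanSpace ℝ ι) → ℝ) (K : ℕ) : ℝ≥0∞ :=
  (Fintype.card ι : ℝ≥0∞) ^ 2 * eLpNorm (wfun K fun ξ => (m ξ : ℂ)) 2 volume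

omit [DecidableEq ι] in
/-- `κ` is monotone in the weight. [folklore] -/
theorem kap_mono (m : (EuclideanSpace ℝ ι) → ℝ) {J K : ℕ} (h : J ≤ K) : kap m J ≤ kap m K :=
  mul_le_mul_right (eLpNorm_wfun_mono h _ 2) _

omit [DecidableEq ι] in
/-- `κ_K < ∞` for a mollifier symbol. [folklore] -/
theorem IsMollifierSymbol.kap_ne_top {m : (EuclideanSpace ℝ ι) → ℝ} (hm : IsMollifierSymbol m) (K : ℕ) :
    kap m K ≠ ∞ :=
  ENNReal.mul_ne_top (ENNReal.pow_ne_top (ENNReal.natCast_ne_top _)) (hm.eLpNorm_wfun_lt_top K).ne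

omit [DecidableEq ι] in
/-- The **contraction modulus** `ρ = C₀(c) T^{1/2} κ_K 4A` of the scheme on `[0, T]` with `L²`
radius `A`. [folklore] -/
def rho (c : ℝ) (m : (EuclideanSpace ℝ ι) → ℝ) (K : ℕ) (T : ℝ) (A : ℝ≥0∞) : ℝ≥0∞ :=
  C₀ c * ENNReal.ofReal T ^ (1 / 2 : ℝ) * kap m K * (4 * A)

omit [DecidableEq ι] in
/-- `ρ` is monotone in the weight. [folklore] -/
theorem rho_mono (c : ℝ) (m : (EuclideanSpace ℝ ι) → ℝ) {J K : ℕ} (h : J ≤ K) (T : ℝ) (A : ℝ≥0∞) :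
    rho c m J T A ≤ rho c m K T A := by
  unfold rho; gcongr; exact kap_mono m h

omit [Fintype ι] [DecidableEq ι] in
/-- The algebra linking the Duhamel bound and `ρ`:
`C x (k (2A) (2B)) = (C x k (4A)) B` in `ℝ≥0∞`. [folklore] -/
theorem duhamel_const_eq (C x k A B : ℝ≥0∞) : C * x * (k * (2 * A) * (2 * B)) = C * x * k * (4 * A) * B := by
  ring

/-! ### The iteration -/

/-- The **regularised Duhamel map** `Φ(v)(t, ξ) = e^{-c‖ξ‖²τ} a(ξ) − D(v, v)(t, ξ)`, `τ = clamp T t`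
(Leray 1934, §26 with §19 (3.11); Ożański–Pooley 2018, (6.77) in mild form). [folklore] -/
def rduhamel (c : ℝ) (m : (EuclideanSpace ℝ ι) → ℝ) (T : ℝ) (a : (EuclideanSpace ℝ ι) → ι → ℂ)
    (v : ℝ → (EuclideanSpace ℝ ι) → ι → ℂ) (t : ℝ) (ξ : EuclideanSpace ℝ ι) : ι → ℂ :=
  heat c ξ (clamp T t) • a ξ - duhamelR c m T v v t ξ

/-- The **Picard iterates** `v₀ = e^{-c‖ξ‖²τ} a`, `v_{n+1} = Φ(v_n)` (Leray 1934, §19/§26,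
approximations successives). [folklore] -/
def rpicardIter (c : ℝ) (m : (EuclideanSpace ℝ ι) → ℝ) (T : ℝ) (a : (EuclideanSpace ℝ ι) → ι → ℂ) :
    ℕ → ℝ → (EuclideanSpace ℝ ι) → ι → ℂ
  | 0 => fun t ξ => heat c ξ (clamp T t) • a ξ
  | n + 1 => rduhamel c m T a (rpicardIter c m T a n)

omit [DecidableEq ι] in
/-- **Hypotheses of the `L²` Picard scheme**: `c > 0`, a mollifier symbol `m`, a time `T > 0`, a
measurable datum with `‖a‖_{L²} ≤ A < ∞`, `‖wfun K a‖_{L²} ≤ AK < ∞`, and the contraction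
condition `2ρ ≤ 1`, which restricts `T` in terms of `A` only. [folklore] -/
structure RPicardHyp (c : ℝ) (m : (EuclideanSpace ℝ ι) → ℝ) (K : ℕ) (T : ℝ) (A AK : ℝ≥0∞)
    (a : (EuclideanSpace ℝ ι) → ι → ℂ) : Prop where
  /-- positivity of the heat rate -/
  hc : 0 < c
  /-- the multiplier is a mollifier symbol -/
  hm : IsMollifierSymbol m
  /-- positivity of the time -/
  hT : 0 < T
  /-- measurability of the datum -/
  meas : Measurable a
  /-- the `L²` size of the datum -/
  boundA : eLpNorm a 2 volume ≤ A
  /-- the weighted `L²` size of the datum -/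
  boundK : eLpNorm (wfun K a) 2 volume ≤ AK
  /-- finiteness -/
  A_ne_top : A ≠ ∞
  /-- finiteness -/
  AK_ne_top : AK ≠ ∞
  /-- the contraction condition `2ρ ≤ 1` -/
  contract : 2 * rho c m K T A ≤ 1

namespace RPicardHyp

variable {c T : ℝ} {m : (EuclideanSpace ℝ ι) → ℝ} {K : ℕ} {A AK : ℝ≥0∞} {a : (EuclideanSpace ℝ ι) → ι → ℂ}

omit [DecidableEq ι] in
/-- `ρ_J ≤ 1` for every `J ≤ K`. [folklore] -/
theorem rho_le_one (h : RPicardHyp c m K T A AK a) {J : ℕ} (hJ : J ≤ K) : rho c m J T A ≤ 1 :=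
  calc rho c m J T A ≤ rho c m K T A := rho_mono c m hJ T A
    _ ≤ 2 * rho c m K T A := le_mul_of_one_le_left zero_le one_le_two
    _ ≤ 1 := h.contract

omit [DecidableEq ι] in
/-- `ρ_K ≤ 1/2` in the form `ρ_K x ≤ ... `: `2 ρ_K ≤ 1`. [folklore] -/
theorem two_mul_rho_le (h : RPicardHyp c m K T A AK a) : 2 * rho c m K T A ≤ 1 := h.contract

/-! #### The heat part -/

omit [DecidableEq ι] in
/-- The heat part `(t, ξ) ↦ e^{-c‖ξ‖²τ} a(ξ)` is jointly measurable. [folklore] -/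
theorem measurable_heatPart (h : RPicardHyp c m K T A AK a) :
    Measurable (uncurry fun (t : ℝ) (ξ : EuclideanSpace ℝ ι) => heat c ξ (clamp T t) • a ξ) := by
  have h1 : Measurable fun p : ℝ × EuclideanSpace ℝ ι => heat c p.2 (clamp T p.1) :=
    (continuous_heat_comp c continuous_snd ((continuous_clamp T).comp continuous_fst)).measurable
  exact h1.smul (h.meas.comp measurable_snd)

omit [DecidableEq ι] in
/-- The heat part does not increase weighted norms pointwise: `‖wfun J (e^{-c‖ξ‖²τ} a) ξ‖ ≤ ‖wfun J a ξ‖`. [folklore] -/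
theorem norm_wfun_heatPart_le (h : RPicardHyp c m K T A AK a) (J : ℕ) (t : ℝ) (ξ : EuclideanSpace ℝ ι) :
    ‖wfun J (fun ξ => heat c ξ (clamp T t) • a ξ) ξ‖ ≤ ‖wfun J a ξ‖ := by
  rw [norm_wfun, norm_wfun, norm_heat_smul]
  refine mul_le_mul_of_nonneg_left ?_ (by positivity)
  exact mul_le_of_le_one_left (norm_nonneg _) (heat_le_one h.hc.le (clamp_nonneg T t) ξ)

omit [DecidableEq ι] in
/-- Weighted `L²` size of the heat part: `‖wfun J (e^{-c‖ξ‖²τ} a)‖_{L²} ≤ ‖wfun J a‖_{L²}`. [folklore] -/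
theorem eLpNorm_wfun_heatPart_le (h : RPicardHyp c m K T A AK a) (J : ℕ) (t : ℝ) :
    eLpNorm (wfun J fun ξ => heat c ξ (clamp T t) • a ξ) 2 volume ≤ eLpNorm (wfun J a) 2 volume :=
  eLpNorm_mono fun ξ => h.norm_wfun_heatPart_le J t ξ

/-! #### The invariant of the iteration -/

/-- **The invariant of the iteration.** Every iterate is jointly measurable, continuous in `t` at
each frequency, and obeys `‖v_n(t)‖_{L²} ≤ 2A`, `‖wfun K v_n(t)‖_{L²} ≤ 2AK` for all `t`
(Leray 1934, §19: the approximations stay in a ball; two-norm form). [folklore] -/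
theorem iter_inv (h : RPicardHyp c m K T A AK a) (n : ℕ) :
    Measurable (uncurry (rpicardIter c m T a n)) ∧
    (∀ t, eLpNorm (rpicardIter c m T a n t) 2 volume ≤ 2 * A) ∧
    (∀ t, eLpNorm (wfun K (rpicardIter c m T a n t)) 2 volume ≤ 2 * AK) ∧
    (∀ ξ, Continuous fun t => rpicardIter c m T a n t ξ) := by
  induction n with
  | zero =>
    refine ⟨h.measurable_heatPart, fun t => ?_, fun t => ?_, fun ξ => ?_⟩
    · change eLpNorm (fun ξ => heat c ξ (clamp T t) • a ξ) 2 volume ≤ 2 * A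
      calc eLpNorm (fun ξ => heat c ξ (clamp T t) • a ξ) 2 volume ≤ eLpNorm a 2 volume := by
            simpa using h.eLpNorm_wfun_heatPart_le 0 t
        _ ≤ A := h.boundA
        _ ≤ 2 * A := le_mul_of_one_le_left zero_le one_le_two
    · calc eLpNorm (wfun K (rpicardIter c m T a 0 t)) 2 volume ≤ eLpNorm (wfun K a) 2 volume :=
            h.eLpNorm_wfun_heatPart_le K t
        _ ≤ AK := h.boundK
        _ ≤ 2 * AK := le_mul_of_one_le_left zero_le one_le_two
    · exact (continuous_heat_comp c continuous_const (continuous_clamp T)).smul continuous_const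
  | succ n ih =>
    obtain ⟨hmeas, hA2, hK2, hcont⟩ := ih
    have hS : SliceBound K (2 * A) (2 * AK) (rpicardIter c m T a n) (rpicardIter c m T a n) :=
      ⟨hmeas, hmeas, hA2, hK2, ENNReal.mul_ne_top ENNReal.ofNat_ne_top h.A_ne_top,
        ENNReal.mul_ne_top ENNReal.ofNat_ne_top h.AK_ne_top⟩
    have hS₀ : SliceBound 0 (2 * A) (2 * A) (rpicardIter c m T a n) (rpicardIter c m T a n) :=
      ⟨hmeas, hmeas, hA2, fun t => by simpa using hA2 t, ENNReal.mul_ne_top ENNReal.ofNat_ne_top h.A_ne_top,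
        ENNReal.mul_ne_top ENNReal.ofNat_ne_top h.A_ne_top⟩
    have hDm := hS.measurable_uncurry_duhamelR h.hm.measurable h.hm.abs_le_one h.hc.le T
    -- the weighted bound of `Φ(v_n)` for a weight `J ≤ K` with datum size `B`
    have key : ∀ {J : ℕ} {B : ℝ≥0∞}, J ≤ K → eLpNorm (wfun J a) 2 volume ≤ B →
        SliceBound J (2 * A) (2 * B) (rpicardIter c m T a n) (rpicardIter c m T a n) →
        ∀ t, eLpNorm (wfun J (rpicardIter c m T a (n + 1) t)) 2 volume ≤ 2 * B := by
      intro J B hJ hB hSJ t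
      have hsplit : wfun J (rpicardIter c m T a (n + 1) t) =
          wfun J (fun ξ => heat c ξ (clamp T t) • a ξ) - wfun J (duhamelR c m T (rpicardIter c m T a n)
            (rpicardIter c m T a n) t) := by
        funext ξ
        simp only [wfun_apply, Pi.sub_apply, rpicardIter, rduhamel, smul_sub]
      rw [hsplit]
      refine (eLpNorm_sub_le (aestronglyMeasurable_wfun J (h.measurable_heatPart.comp
        (measurable_const.prodMk measurable_id) |>.aestronglyMeasurable |>.congr (ae_of_all _ fun ξ => rfl)))
        (aestronglyMeasurable_wfun J ((hSJ.measurable_duhamelR_slice h.hm.measurable c T t).aestronglyMeasurable))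
        one_le_two).trans ?_
      have hD := hSJ.eLpNorm_wfun_duhamelR_le h.hm.measurable h.hc h.hT.le t
      calc eLpNorm (wfun J fun ξ => heat c ξ (clamp T t) • a ξ) 2 volume +
            eLpNorm (wfun J (duhamelR c m T (rpicardIter c m T a n) (rpicardIter c m T a n) t)) 2 volume
          ≤ B + rho c m J T A * B := by
            refine add_le_add ((h.eLpNorm_wfun_heatPart_le J t).trans hB) (hD.trans (le_of_eq ?_))
            rw [rho, kap, C₀]
            ring
        _ ≤ B + 1 * B := add_le_add le_rfl (mul_le_mul_left (h.rho_le_one hJ) _)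
        _ = 2 * B := by rw [one_mul, two_mul]
    refine ⟨?_, ?_, key le_rfl h.boundK hS, fun ξ => ?_⟩
    · -- measurability of `Φ(v_n)`
      exact h.measurable_heatPart.sub hDm
    · -- the `L²` bound
      intro t
      simpa using key (Nat.zero_le K) (by simpa using h.boundA) hS₀ t
    · -- continuity in `t`
      exact ((continuous_heat_comp c continuous_const (continuous_clamp T)).smul continuous_const).sub
        (hS.continuous_duhamelR_time h.hm.measurable h.hm.abs_le_one h.hc.le T ξ)

/-- Joint measurability of the iterates. [folklore] -/
theorem measurable_iter (h : RPicardHyp c m K T A AK a) (n : ℕ) :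
    Measurable (uncurry (rpicardIter c m T a n)) := (h.iter_inv n).1

/-- The `L²` bound of the iterates. [folklore] -/
theorem eLpNorm_iter_le (h : RPicardHyp c m K T A AK a) (n : ℕ) (t : ℝ) :
    eLpNorm (rpicardIter c m T a n t) 2 volume ≤ 2 * A := (h.iter_inv n).2.1 t

/-- The weighted `L²` bound of the iterates. [folklore] -/
theorem eLpNorm_wfun_iter_le (h : RPicardHyp c m K T A AK a) (n : ℕ) (t : ℝ) :
    eLpNorm (wfun K (rpicardIter c m T a n t)) 2 volume ≤ 2 * AK := (h.iter_inv n).2.2.1 t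

/-- Continuity in time of the iterates at each frequency. [folklore] -/
theorem continuous_iter (h : RPicardHyp c m K T A AK a) (n : ℕ) (ξ : EuclideanSpace ℝ ι) :
    Continuous fun t => rpicardIter c m T a n t ξ := (h.iter_inv n).2.2.2 ξ

/-- The slice bounds of the pair `(v_n, v_n)` at weight `K`. [folklore] -/
theorem sliceBound_iter (h : RPicardHyp c m K T A AK a) (n : ℕ) :
    SliceBound K (2 * A) (2 * AK) (rpicardIter c m T a n) (rpicardIter c m T a n) :=
  ⟨h.measurable_iter n, h.measurable_iter n, h.eLpNorm_iter_le n, h.eLpNorm_wfun_iter_le n,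
    ENNReal.mul_ne_top ENNReal.ofNat_ne_top h.A_ne_top, ENNReal.mul_ne_top ENNReal.ofNat_ne_top h.AK_ne_top⟩

/-! #### Geometric decay of the differences -/

/-- The slice bounds of the pair `(v_n, v_n)` at weight `0`. [folklore] -/
theorem sliceBound_iter₀ (h : RPicardHyp c m K T A AK a) (n : ℕ) :
    SliceBound 0 (2 * A) (2 * A) (rpicardIter c m T a n) (rpicardIter c m T a n) :=
  ⟨h.measurable_iter n, h.measurable_iter n, h.eLpNorm_iter_le n, fun t => by simpa using h.eLpNorm_iter_le n t,
    ENNReal.mul_ne_top ENNReal.ofNat_ne_top h.A_ne_top, ENNReal.mul_ne_top ENNReal.ofNat_ne_top h.A_ne_top⟩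

/-- Mixed slice bounds of a pair of iterates `(v_n, v_k)` at weight `J ≤ K`-type data: any two
iterates satisfy `SliceBound J (2A) (2AK)` (resp. `(2A) (2A)` at weight `0`). [folklore] -/
theorem sliceBound_iter_pair (h : RPicardHyp c m K T A AK a) (n k : ℕ) :
    SliceBound K (2 * A) (2 * AK) (rpicardIter c m T a n) (rpicardIter c m T a k) :=
  ⟨h.measurable_iter n, h.measurable_iter k, h.eLpNorm_iter_le n, h.eLpNorm_wfun_iter_le k,
    ENNReal.mul_ne_top ENNReal.ofNat_ne_top h.A_ne_top, ENNReal.mul_ne_top ENNReal.ofNat_ne_top h.AK_ne_top⟩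

/-- **The difference of consecutive iterates is a sum of two Duhamel terms**:
`v_{n+2} − v_{n+1} = −(D(v_{n+1} − v_n, v_{n+1}) + D(v_n, v_{n+1} − v_n))` pointwise (bilinearity). [folklore] -/
theorem iter_sub_succ (h : RPicardHyp c m K T A AK a) (n : ℕ) (t : ℝ) (ξ : EuclideanSpace ℝ ι) :
    rpicardIter c m T a (n + 2) t ξ - rpicardIter c m T a (n + 1) t ξ =
      -(duhamelR c m T (rpicardIter c m T a (n + 1) - rpicardIter c m T a n) (rpicardIter c m T a (n + 1)) t ξ +
        duhamelR c m T (rpicardIter c m T a n) (rpicardIter c m T a (n + 1) - rpicardIter c m T a n) t ξ) := by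
  have hm := h.hm.measurable
  have hm1 := h.hm.abs_le_one
  rw [duhamelR_sub_left (h.sliceBound_iter_pair (n + 1) (n + 1)) (h.sliceBound_iter_pair n (n + 1)) hm hm1
      h.hc.le T t ξ,
    duhamelR_sub_right (h.sliceBound_iter_pair n (n + 1)) (h.sliceBound_iter_pair n n) hm hm1 h.hc.le T t ξ]
  simp only [rpicardIter, rduhamel]
  abel

/-- `v₁ − v₀ = −D(v₀, v₀)`. [folklore] -/
theorem iter_one_sub_zero (t : ℝ) (ξ : EuclideanSpace ℝ ι) :
    rpicardIter c m T a 1 t ξ - rpicardIter c m T a 0 t ξ =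
      -duhamelR c m T (rpicardIter c m T a 0) (rpicardIter c m T a 0) t ξ := by
  simp only [rpicardIter, rduhamel]
  abel

/-- The algebra of the contraction step:
`C x (k (r A) (2B)) + C x (k (2A) (r B)) = (C x k (4A)) B r` in `ℝ≥0∞`. [folklore] -/
theorem contract_const_eq (C x k A B r : ℝ≥0∞) :
    C * x * (k * (r * A) * (2 * B)) + C * x * (k * (2 * A) * (r * B)) = C * x * k * (4 * A) * B * r := by
  ring

/-- Measurability of the differences. [folklore] -/
theorem measurable_iter_sub (h : RPicardHyp c m K T A AK a) (n k : ℕ) :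
    Measurable (uncurry (rpicardIter c m T a n - rpicardIter c m T a k)) :=
  (h.measurable_iter n).sub (h.measurable_iter k)

/-- **Geometric decay of the differences in both norms**: with `ρ = ρ_K`,
`‖(v_{n+1} − v_n)(t)‖_{L²} ≤ ρ^{n+1} A` and `‖wfun K (v_{n+1} − v_n)(t)‖_{L²} ≤ ρ^{n+1} AK`
(two-norm contraction; Leray 1934, §19). [folklore] -/
theorem eLpNorm_iter_sub_le (h : RPicardHyp c m K T A AK a) (n : ℕ) :
    (∀ t, eLpNorm (rpicardIter c m T a (n + 1) t - rpicardIter c m T a n t) 2 volume ≤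
        rho c m K T A ^ (n + 1) * A) ∧
    (∀ t, eLpNorm (wfun K (rpicardIter c m T a (n + 1) t - rpicardIter c m T a n t)) 2 volume ≤
        rho c m K T A ^ (n + 1) * AK) := by
  have hm := h.hm.measurable
  have hm1 := h.hm.abs_le_one
  set ρ := rho c m K T A with hρ
  -- the bound of one Duhamel term at weight `J ≤ K`: `‖wfun J D(V,W)(t)‖ ≤ C₀ T^{1/2} κ_J A' B'`
  have hDJ : ∀ {J : ℕ} {A' B' : ℝ≥0∞} {V W : ℝ → (EuclideanSpace ℝ ι) → ι → ℂ}, SliceBound J A' B' V W →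
      ∀ t, eLpNorm (wfun J (duhamelR c m T V W t)) 2 volume ≤
        C₀ c * ENNReal.ofReal T ^ (1 / 2 : ℝ) * (kap m J * A' * B') := by
    intro J A' B' V W hS t
    refine (hS.eLpNorm_wfun_duhamelR_le hm h.hc h.hT.le t).trans (le_of_eq ?_)
    rw [kap, C₀]; ring
  induction n with
  | zero =>
    -- `v₁ − v₀ = −D(v₀,v₀)`
    have hfun : ∀ t, (rpicardIter c m T a 1 t - rpicardIter c m T a 0 t) =
        fun ξ => -duhamelR c m T (rpicardIter c m T a 0) (rpicardIter c m T a 0) t ξ := fun t => by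
      funext ξ; exact iter_one_sub_zero t ξ
    have key : ∀ {J : ℕ} {B : ℝ≥0∞}, J ≤ K → SliceBound J (2 * A) (2 * B) (rpicardIter c m T a 0) (rpicardIter c m T a 0) →
        ∀ t, eLpNorm (wfun J (rpicardIter c m T a 1 t - rpicardIter c m T a 0 t)) 2 volume ≤ ρ ^ (0 + 1) * B := by
      intro J B hJ hS t
      rw [hfun t]
      have hneg : wfun J (fun ξ => -duhamelR c m T (rpicardIter c m T a 0) (rpicardIter c m T a 0) t ξ) =
          -wfun J (duhamelR c m T (rpicardIter c m T a 0) (rpicardIter c m T a 0) t) := by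
        funext ξ; simp [wfun]
      rw [hneg, eLpNorm_neg]
      refine (hDJ hS t).trans ?_
      rw [zero_add, pow_one, duhamel_const_eq, ← rho]
      exact mul_le_mul_left ((rho_mono c m hJ T A)) _ |>.trans (le_of_eq (by ring))
    refine ⟨fun t => ?_, key le_rfl (h.sliceBound_iter 0)⟩
    simpa using key (Nat.zero_le K) (h.sliceBound_iter₀ 0) t
  | succ n ih =>
    obtain ⟨ih0, ihK⟩ := ih
    set d := rpicardIter c m T a (n + 1) - rpicardIter c m T a n with hd
    have hdm : Measurable (uncurry d) := h.measurable_iter_sub (n + 1) n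
    have hfun : ∀ t, (rpicardIter c m T a (n + 2) t - rpicardIter c m T a (n + 1) t) =
        fun ξ => -(duhamelR c m T d (rpicardIter c m T a (n + 1)) t ξ + duhamelR c m T (rpicardIter c m T a n) d t ξ) :=
      fun t => by funext ξ; exact h.iter_sub_succ n t ξ
    have hρtop : ρ ^ (n + 1) ≠ ∞ := ENNReal.pow_ne_top
      (ne_top_of_le_ne_top ENNReal.one_ne_top (h.rho_le_one le_rfl))
    -- slice bounds of the two pairs, at weight `J`
    have key : ∀ {J : ℕ} {B : ℝ≥0∞}, J ≤ K → B ≠ ∞ →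
        (∀ t, eLpNorm (wfun J (rpicardIter c m T a (n + 1) t)) 2 volume ≤ 2 * B) →
        (∀ t, eLpNorm (wfun J (d t)) 2 volume ≤ ρ ^ (n + 1) * B) →
        ∀ t, eLpNorm (wfun J (rpicardIter c m T a (n + 2) t - rpicardIter c m T a (n + 1) t)) 2 volume ≤
          ρ ^ (n + 1 + 1) * B := by
      intro J B hJ hBtop hvJ hdJ t
      have hS₁ : SliceBound J (ρ ^ (n + 1) * A) (2 * B) d (rpicardIter c m T a (n + 1)) :=
        ⟨hdm, h.measurable_iter (n + 1), fun s => by simpa [hd] using ih0 s, hvJ,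
          ENNReal.mul_ne_top hρtop h.A_ne_top, ENNReal.mul_ne_top ENNReal.ofNat_ne_top hBtop⟩
      have hS₂ : SliceBound J (2 * A) (ρ ^ (n + 1) * B) (rpicardIter c m T a n) d :=
        ⟨h.measurable_iter n, hdm, h.eLpNorm_iter_le n, hdJ,
          ENNReal.mul_ne_top ENNReal.ofNat_ne_top h.A_ne_top, ENNReal.mul_ne_top hρtop hBtop⟩
      rw [hfun t]
      have hneg : wfun J (fun ξ => -(duhamelR c m T d (rpicardIter c m T a (n + 1)) t ξ +
          duhamelR c m T (rpicardIter c m T a n) d t ξ)) =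
          -(wfun J (duhamelR c m T d (rpicardIter c m T a (n + 1)) t) +
            wfun J (duhamelR c m T (rpicardIter c m T a n) d t)) := by
        funext ξ; simp [wfun, smul_add]
      rw [hneg, eLpNorm_neg]
      refine (eLpNorm_add_le (aestronglyMeasurable_wfun J ((hS₁.measurable_duhamelR_slice hm c T t).aestronglyMeasurable))
        (aestronglyMeasurable_wfun J ((hS₂.measurable_duhamelR_slice hm c T t).aestronglyMeasurable)) one_le_two).trans ?_
      refine (add_le_add (hDJ hS₁ t) (hDJ hS₂ t)).trans ?_
      rw [contract_const_eq, ← rho, pow_succ ρ (n + 1)]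
      calc rho c m J T A * B * ρ ^ (n + 1) ≤ ρ * B * ρ ^ (n + 1) := by gcongr; exact rho_mono c m hJ T A
        _ = ρ ^ (n + 1) * ρ * B := by ring
    have hK' := key le_rfl h.AK_ne_top (h.eLpNorm_wfun_iter_le (n + 1)) (fun t => by simpa [hd] using ihK t)
    have h0' := key (Nat.zero_le K) h.A_ne_top (fun t => by simpa using h.eLpNorm_iter_le (n + 1) t)
      (fun t => by simpa [hd] using ih0 t)
    exact ⟨fun t => by simpa using h0' t, hK'⟩


/-! #### Pointwise decay of the differences -/

omit [DecidableEq ι] in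
/-- `ρ ≤ 1/2`. [folklore] -/
theorem rho_le_half (h : RPicardHyp c m K T A AK a) : rho c m K T A ≤ 2⁻¹ := by
  rw [ENNReal.le_inv_iff_mul_le, mul_comm]
  exact h.contract

/-- **Pointwise geometric decay of the differences** at weight `K`: with `(1+‖ξ‖)^K |m| ≤ M`,
`(1+‖ξ‖)^K ‖v_{n+1}(t,ξ) − v_n(t,ξ)‖ ≤ C_pt ρⁿ`, `C_pt = C₀ T^{1/2} card² M 4A AK`, at EVERY
`(t, ξ)`: the Duhamel terms of `L²`-small fields are pointwise small (Cauchy–Schwarz). [folklore] -/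
theorem weight_mul_enorm_iter_sub_le (h : RPicardHyp c m K T A AK a) {M : ℝ}
    (hM : ∀ ξ, (1 + ‖ξ‖) ^ K * |m ξ| ≤ M) (n : ℕ) (t : ℝ) (ξ : EuclideanSpace ℝ ι) :
    ENNReal.ofReal ((1 + ‖ξ‖) ^ K) * ‖rpicardIter c m T a (n + 1) t ξ - rpicardIter c m T a n t ξ‖ₑ ≤
      (C₀ c * ENNReal.ofReal T ^ (1 / 2 : ℝ) * (Fintype.card ι : ℝ≥0∞) ^ 2 * ENNReal.ofReal M * (4 * A) * AK) *
        rho c m K T A ^ n := by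
  have hm := h.hm.measurable
  -- the pointwise bound of one Duhamel term at weight `K`
  have hDpt : ∀ {A' B' : ℝ≥0∞} {V W : ℝ → (EuclideanSpace ℝ ι) → ι → ℂ}, SliceBound K A' B' V W →
      ENNReal.ofReal ((1 + ‖ξ‖) ^ K) * ‖duhamelR c m T V W t ξ‖ₑ ≤
        C₀ c * ENNReal.ofReal T ^ (1 / 2 : ℝ) * ((Fintype.card ι : ℝ≥0∞) ^ 2 * (ENNReal.ofReal M * A' * B')) := by
    intro A' B' V W hS
    refine (hS.weight_mul_enorm_duhamelR_le hm h.hc h.hT.le hM t ξ).trans (le_of_eq ?_)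
    rw [C₀]
  cases n with
  | zero =>
    rw [iter_one_sub_zero, enorm_neg, pow_zero, mul_one]
    refine (hDpt (h.sliceBound_iter 0)).trans (le_of_eq ?_)
    ring
  | succ k =>
    obtain ⟨hk0, hkK⟩ := h.eLpNorm_iter_sub_le k
    set d := rpicardIter c m T a (k + 1) - rpicardIter c m T a k with hd
    have hdm : Measurable (uncurry d) := h.measurable_iter_sub (k + 1) k
    have hρtop : rho c m K T A ^ (k + 1) ≠ ∞ := ENNReal.pow_ne_top
      (ne_top_of_le_ne_top ENNReal.one_ne_top (h.rho_le_one le_rfl))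
    have hS₁ : SliceBound K (rho c m K T A ^ (k + 1) * A) (2 * AK) d (rpicardIter c m T a (k + 1)) :=
      ⟨hdm, h.measurable_iter (k + 1), fun s => by simpa [hd] using hk0 s, h.eLpNorm_wfun_iter_le (k + 1),
        ENNReal.mul_ne_top hρtop h.A_ne_top, ENNReal.mul_ne_top ENNReal.ofNat_ne_top h.AK_ne_top⟩
    have hS₂ : SliceBound K (2 * A) (rho c m K T A ^ (k + 1) * AK) (rpicardIter c m T a k) d :=
      ⟨h.measurable_iter k, hdm, h.eLpNorm_iter_le k, fun s => by simpa [hd] using hkK s,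
        ENNReal.mul_ne_top ENNReal.ofNat_ne_top h.A_ne_top, ENNReal.mul_ne_top hρtop h.AK_ne_top⟩
    rw [show k + 1 + 1 = k + 2 from rfl, h.iter_sub_succ k t ξ, enorm_neg]
    calc ENNReal.ofReal ((1 + ‖ξ‖) ^ K) * ‖duhamelR c m T d (rpicardIter c m T a (k + 1)) t ξ +
          duhamelR c m T (rpicardIter c m T a k) d t ξ‖ₑ
        ≤ ENNReal.ofReal ((1 + ‖ξ‖) ^ K) * (‖duhamelR c m T d (rpicardIter c m T a (k + 1)) t ξ‖ₑ +
            ‖duhamelR c m T (rpicardIter c m T a k) d t ξ‖ₑ) := mul_le_mul_right (enorm_add_le _ _) _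
      _ = ENNReal.ofReal ((1 + ‖ξ‖) ^ K) * ‖duhamelR c m T d (rpicardIter c m T a (k + 1)) t ξ‖ₑ +
            ENNReal.ofReal ((1 + ‖ξ‖) ^ K) * ‖duhamelR c m T (rpicardIter c m T a k) d t ξ‖ₑ := mul_add _ _ _
      _ ≤ _ := add_le_add (hDpt hS₁) (hDpt hS₂)
      _ = _ := by ring

omit [DecidableEq ι] in
/-- The pointwise constant is finite. [folklore] -/
theorem Cpt_ne_top (h : RPicardHyp c m K T A AK a) (M : ℝ) :
    C₀ c * ENNReal.ofReal T ^ (1 / 2 : ℝ) * (Fintype.card ι : ℝ≥0∞) ^ 2 * ENNReal.ofReal M * (4 * A) * AK ≠ ∞ := by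
  refine ENNReal.mul_ne_top (ENNReal.mul_ne_top (ENNReal.mul_ne_top (ENNReal.mul_ne_top (ENNReal.mul_ne_top
    (C₀_ne_top c) (ENNReal.rpow_ne_top_of_nonneg (by norm_num) ENNReal.ofReal_ne_top))
    (ENNReal.pow_ne_top (ENNReal.natCast_ne_top _))) ENNReal.ofReal_ne_top)
    (ENNReal.mul_ne_top ENNReal.ofNat_ne_top h.A_ne_top)) h.AK_ne_top

/-- **Real form of the pointwise decay**: there is `C ≥ 0` with
`‖v_{n+1}(t,ξ) − v_n(t,ξ)‖ ≤ C 2^{-n}` for all `n, t, ξ` (drop the weight `≥ 1`, use `ρ ≤ 1/2`). [folklore] -/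
theorem exists_norm_iter_sub_le (h : RPicardHyp c m K T A AK a) :
    ∃ C : ℝ, 0 ≤ C ∧ ∀ n t (ξ : EuclideanSpace ℝ ι),
      ‖rpicardIter c m T a (n + 1) t ξ - rpicardIter c m T a n t ξ‖ ≤ C * (1 / 2) ^ n := by
  obtain ⟨M, -, hM⟩ := h.hm.decay' K
  set Cpt := C₀ c * ENNReal.ofReal T ^ (1 / 2 : ℝ) * (Fintype.card ι : ℝ≥0∞) ^ 2 * ENNReal.ofReal M * (4 * A) * AK
    with hCpt
  have htop : Cpt ≠ ∞ := h.Cpt_ne_top M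
  refine ⟨Cpt.toReal, ENNReal.toReal_nonneg, fun n t ξ => ?_⟩
  have h1 := h.weight_mul_enorm_iter_sub_le hM n t ξ
  have h2 : ‖rpicardIter c m T a (n + 1) t ξ - rpicardIter c m T a n t ξ‖ₑ ≤ Cpt * 2⁻¹ ^ n := by
    calc ‖rpicardIter c m T a (n + 1) t ξ - rpicardIter c m T a n t ξ‖ₑ
        ≤ ENNReal.ofReal ((1 + ‖ξ‖) ^ K) * ‖rpicardIter c m T a (n + 1) t ξ - rpicardIter c m T a n t ξ‖ₑ :=
          le_mul_of_one_le_left zero_le (ENNReal.one_le_ofReal.2 (one_le_one_add_norm_pow ξ K))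
      _ ≤ Cpt * rho c m K T A ^ n := h1
      _ ≤ Cpt * 2⁻¹ ^ n := by gcongr; exact h.rho_le_half
  have h3 : (Cpt * 2⁻¹ ^ n).toReal = Cpt.toReal * (1 / 2) ^ n := by
    rw [ENNReal.toReal_mul, ENNReal.toReal_pow, ENNReal.toReal_inv]; norm_num
  rw [← h3, ← toReal_enorm]
  exact ENNReal.toReal_mono (ENNReal.mul_ne_top htop (ENNReal.pow_ne_top (ENNReal.inv_ne_top.2 two_ne_zero))) h2


/-- The constant of the pointwise decay (a choice). [folklore] -/
def Cr (h : RPicardHyp c m K T A AK a) : ℝ := h.exists_norm_iter_sub_le.choose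

/-- `0 ≤ Cr`. [folklore] -/
theorem Cr_nonneg (h : RPicardHyp c m K T A AK a) : 0 ≤ h.Cr := h.exists_norm_iter_sub_le.choose_spec.1

/-- The pointwise decay with the chosen constant. [folklore] -/
theorem norm_iter_sub_le (h : RPicardHyp c m K T A AK a) (n : ℕ) (t : ℝ) (ξ : EuclideanSpace ℝ ι) :
    ‖rpicardIter c m T a (n + 1) t ξ - rpicardIter c m T a n t ξ‖ ≤ h.Cr * (1 / 2) ^ n :=
  h.exists_norm_iter_sub_le.choose_spec.2 n t ξ

/-- The iterates form a Cauchy sequence at every point. [folklore] -/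
theorem dist_iter_le (h : RPicardHyp c m K T A AK a) (t : ℝ) (ξ : EuclideanSpace ℝ ι) (n : ℕ) :
    dist (rpicardIter c m T a n t ξ) (rpicardIter c m T a (n + 1) t ξ) ≤ h.Cr * (1 / 2) ^ n := by
  rw [dist_comm, dist_eq_norm]
  exact h.norm_iter_sub_le n t ξ

/-- The pointwise Cauchy property. [folklore] -/
theorem cauchySeq_iter (h : RPicardHyp c m K T A AK a) (t : ℝ) (ξ : EuclideanSpace ℝ ι) :
    CauchySeq fun n => rpicardIter c m T a n t ξ :=
  cauchySeq_of_le_geometric (1 / 2) _ (by norm_num) (h.dist_iter_le t ξ)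

end RPicardHyp

/-! ### The limit -/

/-- **The Picard limit** `v(t, ξ) = lim_n v_n(t, ξ)` of the `L²` scheme (pointwise limit;
Leray 1934, §19/§26). [folklore] -/
def rpicardLimit (c : ℝ) (m : (EuclideanSpace ℝ ι) → ℝ) (T : ℝ) (a : (EuclideanSpace ℝ ι) → ι → ℂ) (t : ℝ)
    (ξ : EuclideanSpace ℝ ι) : ι → ℂ :=
  limUnder atTop fun n => rpicardIter c m T a n t ξ

namespace RPicardHyp

variable {c T : ℝ} {m : (EuclideanSpace ℝ ι) → ℝ} {K : ℕ} {A AK : ℝ≥0∞} {a : (EuclideanSpace ℝ ι) → ι → ℂ}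

/-- The iterates converge to the limit. [folklore] -/
theorem tendsto_iter (h : RPicardHyp c m K T A AK a) (t : ℝ) (ξ : EuclideanSpace ℝ ι) :
    Tendsto (fun n => rpicardIter c m T a n t ξ) atTop (𝓝 (rpicardLimit c m T a t ξ)) :=
  (h.cauchySeq_iter t ξ).tendsto_limUnder

/-- **Rate of the pointwise convergence**: `‖v_n(t,ξ) − v(t,ξ)‖ ≤ 2 Cr 2^{-n}`. [folklore] -/
theorem norm_iter_sub_limit_le (h : RPicardHyp c m K T A AK a) (n : ℕ) (t : ℝ) (ξ : EuclideanSpace ℝ ι) :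
    ‖rpicardIter c m T a n t ξ - rpicardLimit c m T a t ξ‖ ≤ 2 * h.Cr * (1 / 2) ^ n := by
  have := dist_le_of_le_geometric_of_tendsto (r := 1 / 2) (C := h.Cr) (by norm_num) (h.dist_iter_le t ξ)
    (h.tendsto_iter t ξ) n
  rw [dist_eq_norm] at this
  convert this using 1
  norm_num; ring

/-- The convergence is uniform on `ℝ × E`. [folklore] -/
theorem tendstoUniformly_iter (h : RPicardHyp c m K T A AK a) :
    TendstoUniformly (fun n => uncurry (rpicardIter c m T a n)) (uncurry (rpicardLimit c m T a)) atTop := by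
  rw [Metric.tendstoUniformly_iff]
  intro ε hε
  have hR := h.Cr_nonneg
  obtain ⟨N, hN⟩ : ∃ N : ℕ, 2 * h.Cr * (1 / 2 : ℝ) ^ N < ε := by
    have : Tendsto (fun n : ℕ => 2 * h.Cr * (1 / 2 : ℝ) ^ n) atTop (𝓝 (2 * h.Cr * 0)) :=
      (tendsto_pow_atTop_nhds_zero_of_lt_one (by norm_num) (by norm_num)).const_mul _
    rw [mul_zero] at this
    exact (this.eventually (gt_mem_nhds hε)).exists
  refine eventually_atTop.2 ⟨N, fun n hn p => ?_⟩
  rw [dist_comm, dist_eq_norm]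
  have hpow : (1 / 2 : ℝ) ^ n ≤ (1 / 2) ^ N := pow_le_pow_of_le_one (by norm_num) (by norm_num) hn
  calc ‖uncurry (rpicardIter c m T a n) p - uncurry (rpicardLimit c m T a) p‖
      ≤ 2 * h.Cr * (1 / 2) ^ n := h.norm_iter_sub_limit_le n p.1 p.2
    _ ≤ 2 * h.Cr * (1 / 2) ^ N := mul_le_mul_of_nonneg_left hpow (by positivity)
    _ < ε := hN

/-- The convergence is uniform in `t` at each frequency. [folklore] -/
theorem tendstoUniformly_iter_time (h : RPicardHyp c m K T A AK a) (ξ : EuclideanSpace ℝ ι) :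
    TendstoUniformly (fun n t => rpicardIter c m T a n t ξ) (fun t => rpicardLimit c m T a t ξ) atTop := by
  have := h.tendstoUniformly_iter.comp (fun t : ℝ => (t, ξ))
  exact this

/-- **The limit is jointly measurable** (pointwise limit of jointly measurable maps). [folklore] -/
theorem measurable_limit (h : RPicardHyp c m K T A AK a) : Measurable (uncurry (rpicardLimit c m T a)) :=
  measurable_of_tendsto_metrizable (fun n => h.measurable_iter n)
    (tendsto_pi_nhds.2 fun p => h.tendsto_iter p.1 p.2)

/-- Slices of the limit are measurable. [folklore] -/
theorem measurable_limit_slice (h : RPicardHyp c m K T A AK a) (t : ℝ) : Measurable (rpicardLimit c m T a t) :=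
  measurable_slice h.measurable_limit t

/-- **The limit is continuous in time at each frequency** (uniform limit of continuous maps). [folklore] -/
theorem continuous_limit_time (h : RPicardHyp c m K T A AK a) (ξ : EuclideanSpace ℝ ι) :
    Continuous fun t => rpicardLimit c m T a t ξ :=
  (h.tendstoUniformly_iter_time ξ).continuous (Frequently.of_forall fun n => h.continuous_iter n ξ)

/-- A `liminf` of a sequence bounded by `b` is at most `b`. [folklore] -/
theorem liminf_le_of_forall_le {u : ℕ → ℝ≥0∞} {b : ℝ≥0∞} (hu : ∀ n, u n ≤ b) : liminf u atTop ≤ b :=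
  Filter.liminf_le_of_le (by isBoundedDefault) fun x hx => by
    obtain ⟨n, hn⟩ := hx.exists
    exact hn.trans (hu n)

/-- **The `L²` bound passes to the limit** (Fatou): `‖v(t)‖_{L²} ≤ 2A`. [folklore] -/
theorem eLpNorm_limit_le (h : RPicardHyp c m K T A AK a) (t : ℝ) :
    eLpNorm (rpicardLimit c m T a t) 2 volume ≤ 2 * A := by
  refine (Lp.eLpNorm_lim_le_liminf_eLpNorm (fun n => (measurable_slice (h.measurable_iter n) t).aestronglyMeasurable)
    (rpicardLimit c m T a t) (Eventually.of_forall fun ξ => h.tendsto_iter t ξ)).trans ?_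
  exact liminf_le_of_forall_le fun n => h.eLpNorm_iter_le n t

/-- **The weighted `L²` bound passes to the limit** (Fatou): `‖wfun K v(t)‖_{L²} ≤ 2AK`. [folklore] -/
theorem eLpNorm_wfun_limit_le (h : RPicardHyp c m K T A AK a) (t : ℝ) :
    eLpNorm (wfun K (rpicardLimit c m T a t)) 2 volume ≤ 2 * AK := by
  refine (Lp.eLpNorm_lim_le_liminf_eLpNorm
    (fun n => (measurable_wfun K (measurable_slice (h.measurable_iter n) t)).aestronglyMeasurable)
    (wfun K (rpicardLimit c m T a t)) (Eventually.of_forall fun ξ => ?_)).trans ?_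
  · simp only [wfun_apply]
    exact (h.tendsto_iter t ξ).const_smul _
  · exact liminf_le_of_forall_le fun n => h.eLpNorm_wfun_iter_le n t

/-- The slice bounds of the pair `(v, v)` at weight `K`. [folklore] -/
theorem sliceBound_limit (h : RPicardHyp c m K T A AK a) :
    SliceBound K (2 * A) (2 * AK) (rpicardLimit c m T a) (rpicardLimit c m T a) :=
  ⟨h.measurable_limit, h.measurable_limit, h.eLpNorm_limit_le, h.eLpNorm_wfun_limit_le,
    ENNReal.mul_ne_top ENNReal.ofNat_ne_top h.A_ne_top, ENNReal.mul_ne_top ENNReal.ofNat_ne_top h.AK_ne_top⟩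


/-! #### `L²` convergence of the iterates to the limit -/

omit [Fintype ι] [DecidableEq ι] in
/-- `wfun K 0 = 0`. [folklore] -/
@[simp]
theorem wfun_zero_fun {E' : Type*} [NormedAddCommGroup E'] {F : Type*} [NormedAddCommGroup F] [NormedSpace ℝ F]
    (K : ℕ) : wfun K (0 : E' → F) = 0 := by
  funext ξ; simp [wfun]

omit [DecidableEq ι] in
/-- The geometric tail: `∑_{k ∈ [n, N)} ρ^{k+1} ≤ 2 ρ^{n+1}` for `ρ ≤ 1/2`. [folklore] -/
theorem sum_Ico_pow_le (h : RPicardHyp c m K T A AK a) (n N : ℕ) :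
    ∑ k ∈ Finset.Ico n N, rho c m K T A ^ (k + 1) ≤ 2 * rho c m K T A ^ (n + 1) := by
  set ρ := rho c m K T A with hρ
  rw [Finset.sum_Ico_eq_sum_range]
  have h1 : ∑ k ∈ Finset.range (N - n), ρ ^ (n + k + 1) = ρ ^ (n + 1) * ∑ k ∈ Finset.range (N - n), ρ ^ k := by
    rw [Finset.mul_sum]
    refine Finset.sum_congr rfl fun k _ => ?_
    rw [← pow_add]; congr 1; ring
  rw [h1, mul_comm]
  refine mul_le_mul_left ?_ _
  calc ∑ k ∈ Finset.range (N - n), ρ ^ k ≤ ∑' k, ρ ^ k := ENNReal.sum_le_tsum _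
    _ = (1 - ρ)⁻¹ := ENNReal.tsum_geometric ρ
    _ ≤ (1 - 2⁻¹)⁻¹ := by gcongr; exact h.rho_le_half
    _ = 2 := by rw [ENNReal.one_sub_inv_two, inv_inv]

/-- Weighted `L²` bound of `v_N − v_n` by the geometric tail, for a weight `J` with difference
bounds `‖wfun J (v_{k+1} − v_k)(t)‖ ≤ ρ^{k+1} B`. [folklore] -/
theorem eLpNorm_wfun_iter_sub_iter_le (h : RPicardHyp c m K T A AK a) {J : ℕ} {B : ℝ≥0∞}
    (hd : ∀ k t, eLpNorm (wfun J (rpicardIter c m T a (k + 1) t - rpicardIter c m T a k t)) 2 volume ≤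
      rho c m K T A ^ (k + 1) * B) (n : ℕ) (t : ℝ) :
    ∀ N, n ≤ N → eLpNorm (wfun J (rpicardIter c m T a N t - rpicardIter c m T a n t)) 2 volume ≤
      (∑ k ∈ Finset.Ico n N, rho c m K T A ^ (k + 1)) * B := by
  intro N hN
  induction N, hN using Nat.le_induction with
  | base => simp
  | succ N hN ih =>
    have hsplit : wfun J (rpicardIter c m T a (N + 1) t - rpicardIter c m T a n t) =
        wfun J (rpicardIter c m T a (N + 1) t - rpicardIter c m T a N t) +
          wfun J (rpicardIter c m T a N t - rpicardIter c m T a n t) := by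
      funext ξ; simp only [wfun_apply, Pi.sub_apply, Pi.add_apply, ← smul_add, sub_add_sub_cancel]
    rw [hsplit]
    refine (eLpNorm_add_le (aestronglyMeasurable_wfun J ((measurable_slice (h.measurable_iter_sub (N + 1) N) t)
      |>.aestronglyMeasurable))
      (aestronglyMeasurable_wfun J ((measurable_slice (h.measurable_iter_sub N n) t) |>.aestronglyMeasurable))
      one_le_two).trans ?_
    rw [Finset.sum_Ico_succ_top hN, add_mul]
    exact (add_le_add (hd N t) ih).trans_eq (add_comm _ _)

/-- **`L²` rate of convergence to the limit**: `‖(v − v_n)(t)‖_{L²} ≤ 2 ρ^{n+1} A` (Fatou on the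
telescoping sums). [folklore] -/
theorem eLpNorm_limit_sub_iter_le (h : RPicardHyp c m K T A AK a) (n : ℕ) (t : ℝ) :
    eLpNorm (rpicardLimit c m T a t - rpicardIter c m T a n t) 2 volume ≤ 2 * rho c m K T A ^ (n + 1) * A := by
  have hd : ∀ k t, eLpNorm (wfun 0 (rpicardIter c m T a (k + 1) t - rpicardIter c m T a k t)) 2 volume ≤
      rho c m K T A ^ (k + 1) * A := fun k t => by simpa using (h.eLpNorm_iter_sub_le k).1 t
  have hF := Lp.eLpNorm_lim_le_liminf_eLpNorm (p := 2) (μ := (volume : Measure (EuclideanSpace ℝ ι)))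
    (f := fun N => rpicardIter c m T a N t - rpicardIter c m T a n t)
    (fun N => (measurable_slice (h.measurable_iter_sub N n) t).aestronglyMeasurable)
    (rpicardLimit c m T a t - rpicardIter c m T a n t)
    (Eventually.of_forall fun ξ => (h.tendsto_iter t ξ).sub_const _)
  refine hF.trans (Filter.liminf_le_of_le (by isBoundedDefault) fun x hx => ?_)
  obtain ⟨N, hN, hNn⟩ := (hx.and (eventually_ge_atTop n)).exists
  refine hN.trans ?_
  calc eLpNorm (rpicardIter c m T a N t - rpicardIter c m T a n t) 2 volume
      ≤ (∑ k ∈ Finset.Ico n N, rho c m K T A ^ (k + 1)) * A := by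
        simpa using h.eLpNorm_wfun_iter_sub_iter_le hd n t N hNn
    _ ≤ 2 * rho c m K T A ^ (n + 1) * A := mul_le_mul_left (h.sum_Ico_pow_le n N) _

/-- **Weighted `L²` rate of convergence to the limit**: `‖wfun K (v − v_n)(t)‖_{L²} ≤ 2 ρ^{n+1} AK`. [folklore] -/
theorem eLpNorm_wfun_limit_sub_iter_le (h : RPicardHyp c m K T A AK a) (n : ℕ) (t : ℝ) :
    eLpNorm (wfun K (rpicardLimit c m T a t - rpicardIter c m T a n t)) 2 volume ≤
      2 * rho c m K T A ^ (n + 1) * AK := by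
  have hd : ∀ k t, eLpNorm (wfun K (rpicardIter c m T a (k + 1) t - rpicardIter c m T a k t)) 2 volume ≤
      rho c m K T A ^ (k + 1) * AK := fun k t => (h.eLpNorm_iter_sub_le k).2 t
  have hF := Lp.eLpNorm_lim_le_liminf_eLpNorm (p := 2) (μ := (volume : Measure (EuclideanSpace ℝ ι)))
    (f := fun N => wfun K (rpicardIter c m T a N t - rpicardIter c m T a n t))
    (fun N => (measurable_wfun K (measurable_slice (h.measurable_iter_sub N n) t)).aestronglyMeasurable)
    (wfun K (rpicardLimit c m T a t - rpicardIter c m T a n t))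
    (Eventually.of_forall fun ξ => by
      simp only [wfun_apply, Pi.sub_apply]
      exact ((h.tendsto_iter t ξ).sub_const _).const_smul _)
  refine hF.trans (Filter.liminf_le_of_le (by isBoundedDefault) fun x hx => ?_)
  obtain ⟨N, hN, hNn⟩ := (hx.and (eventually_ge_atTop n)).exists
  refine hN.trans ?_
  calc eLpNorm (wfun K (rpicardIter c m T a N t - rpicardIter c m T a n t)) 2 volume
      ≤ (∑ k ∈ Finset.Ico n N, rho c m K T A ^ (k + 1)) * AK := h.eLpNorm_wfun_iter_sub_iter_le hd n t N hNn
    _ ≤ 2 * rho c m K T A ^ (n + 1) * AK := mul_le_mul_left (h.sum_Ico_pow_le n N) _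

/-! #### The fixed point -/

/-- Every iterate is constant in `t` outside `[0, T]`: `v_n(clamp T t) = v_n(t)`. [folklore] -/
theorem iter_clamp (h : RPicardHyp c m K T A AK a) (n : ℕ) (t : ℝ) (ξ : EuclideanSpace ℝ ι) :
    rpicardIter c m T a n (clamp T t) ξ = rpicardIter c m T a n t ξ := by
  cases n with
  | zero => simp only [rpicardIter, clamp_clamp h.hT.le]
  | succ n => simp only [rpicardIter, rduhamel, clamp_clamp h.hT.le, duhamelR_clamp h.hT.le]

/-- Every iterate starts at the datum: `v_n(0) = a`. [folklore] -/
theorem iter_zero (h : RPicardHyp c m K T A AK a) (n : ℕ) (ξ : EuclideanSpace ℝ ι) : rpicardIter c m T a n 0 ξ = a ξ := by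
  cases n with
  | zero => simp [rpicardIter, clamp_zero h.hT.le]
  | succ n => simp [rpicardIter, rduhamel, clamp_zero h.hT.le, duhamelR_zero h.hT.le]

/-- The limit is constant in `t` outside `[0, T]`. [folklore] -/
theorem limit_clamp (h : RPicardHyp c m K T A AK a) (t : ℝ) (ξ : EuclideanSpace ℝ ι) :
    rpicardLimit c m T a (clamp T t) ξ = rpicardLimit c m T a t ξ :=
  tendsto_nhds_unique (h.tendsto_iter (clamp T t) ξ)
    ((h.tendsto_iter t ξ).congr fun n => (h.iter_clamp n t ξ).symm)

/-- **Initial value of the limit**: `v(0) = a`. [folklore] -/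
theorem limit_zero (h : RPicardHyp c m K T A AK a) (ξ : EuclideanSpace ℝ ι) : rpicardLimit c m T a 0 ξ = a ξ :=
  tendsto_nhds_unique (h.tendsto_iter 0 ξ) (tendsto_const_nhds.congr fun n => (h.iter_zero n ξ).symm)

/-- **The Duhamel terms of the iterates converge pointwise to the Duhamel term of the limit**
(`D(v_n,v_n) − D(v,v) = D(v_n − v, v_n) + D(v, v_n − v)`, each pointwise `≤ C ρ^{n+1}` by the
weight-`0` pointwise bound). [folklore] -/
theorem tendsto_duhamelR_iter (h : RPicardHyp c m K T A AK a) (t : ℝ) (ξ : EuclideanSpace ℝ ι) :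
    Tendsto (fun n => duhamelR c m T (rpicardIter c m T a n) (rpicardIter c m T a n) t ξ) atTop
      (𝓝 (duhamelR c m T (rpicardLimit c m T a) (rpicardLimit c m T a) t ξ)) := by
  have hm := h.hm.measurable
  have hm1 := h.hm.abs_le_one
  set v := rpicardLimit c m T a with hv
  set ρ := rho c m K T A with hρ
  have hρtop : ∀ n, ρ ^ (n + 1) ≠ ∞ := fun n => ENNReal.pow_ne_top
    (ne_top_of_le_ne_top ENNReal.one_ne_top (h.rho_le_one le_rfl))
  have h2A : (2 : ℝ≥0∞) * A ≠ ∞ := ENNReal.mul_ne_top ENNReal.ofNat_ne_top h.A_ne_top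
  -- slice bounds of `(v_n − v, v_n)` and `(v, v_n − v)` at weight `0`
  have hdm : ∀ n, Measurable (uncurry (rpicardIter c m T a n - v)) := fun n =>
    (h.measurable_iter n).sub h.measurable_limit
  have hdb : ∀ n s, eLpNorm ((rpicardIter c m T a n - v) s) 2 volume ≤ 2 * ρ ^ (n + 1) * A := by
    intro n s
    have := h.eLpNorm_limit_sub_iter_le n s
    rwa [← eLpNorm_neg, neg_sub] at this
  have hS₁ : ∀ n, SliceBound 0 (2 * ρ ^ (n + 1) * A) (2 * A) (rpicardIter c m T a n - v) (rpicardIter c m T a n) :=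
    fun n => ⟨hdm n, h.measurable_iter n, hdb n, fun s => by simpa using h.eLpNorm_iter_le n s,
      ENNReal.mul_ne_top (ENNReal.mul_ne_top ENNReal.ofNat_ne_top (hρtop n)) h.A_ne_top, h2A⟩
  have hS₂ : ∀ n, SliceBound 0 (2 * A) (2 * ρ ^ (n + 1) * A) v (rpicardIter c m T a n - v) :=
    fun n => ⟨h.measurable_limit, hdm n, h.eLpNorm_limit_le, fun s => by simpa using hdb n s, h2A,
      ENNReal.mul_ne_top (ENNReal.mul_ne_top ENNReal.ofNat_ne_top (hρtop n)) h.A_ne_top⟩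
  have hSv : SliceBound 0 (2 * A) (2 * A) v v :=
    ⟨h.measurable_limit, h.measurable_limit, h.eLpNorm_limit_le, fun s => by simpa using h.eLpNorm_limit_le s, h2A, h2A⟩
  have hSn : ∀ n, SliceBound 0 (2 * A) (2 * A) (rpicardIter c m T a n) (rpicardIter c m T a n) := h.sliceBound_iter₀
  -- the difference identity
  have hdiff : ∀ n, duhamelR c m T (rpicardIter c m T a n) (rpicardIter c m T a n) t ξ - duhamelR c m T v v t ξ =
      duhamelR c m T (rpicardIter c m T a n - v) (rpicardIter c m T a n) t ξ +
        duhamelR c m T v (rpicardIter c m T a n - v) t ξ := by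
    intro n
    have hVn : SliceBound 0 (2 * A) (2 * A) v (rpicardIter c m T a n) :=
      ⟨h.measurable_limit, h.measurable_iter n, h.eLpNorm_limit_le, fun s => by simpa using h.eLpNorm_iter_le n s, h2A, h2A⟩
    rw [duhamelR_sub_left (hSn n) hVn hm hm1 h.hc.le T t ξ, duhamelR_sub_right hVn hSv hm hm1 h.hc.le T t ξ]
    abel
  -- the pointwise bound at weight `0` with `M = 1`
  have hM : ∀ ξ : EuclideanSpace ℝ ι, (1 + ‖ξ‖) ^ 0 * |m ξ| ≤ 1 := fun ξ => by simpa using hm1 ξ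
  set C' : ℝ≥0∞ := C₀ c * ENNReal.ofReal T ^ (1 / 2 : ℝ) * (Fintype.card ι : ℝ≥0∞) ^ 2 * (2 * A) * (2 * A)
    with hC'
  have hC'top : C' ≠ ∞ := ENNReal.mul_ne_top (ENNReal.mul_ne_top (ENNReal.mul_ne_top (ENNReal.mul_ne_top
    (C₀_ne_top c) (ENNReal.rpow_ne_top_of_nonneg (by norm_num) ENNReal.ofReal_ne_top))
    (ENNReal.pow_ne_top (ENNReal.natCast_ne_top _))) h2A) h2A
  have hbound : ∀ n, edist (duhamelR c m T (rpicardIter c m T a n) (rpicardIter c m T a n) t ξ)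
      (duhamelR c m T v v t ξ) ≤ C' * (2 * ρ ^ (n + 1)) := by
    intro n
    rw [edist_eq_enorm_sub, hdiff n]
    have h1 := (hS₁ n).weight_mul_enorm_duhamelR_le hm h.hc h.hT.le hM t ξ
    have h2 := (hS₂ n).weight_mul_enorm_duhamelR_le hm h.hc h.hT.le hM t ξ
    simp only [pow_zero, ENNReal.ofReal_one, one_mul] at h1 h2
    refine (enorm_add_le _ _).trans ((add_le_add h1 h2).trans (le_of_eq ?_))
    rw [hC', C₀]; ring
  have hlim : Tendsto (fun n => C' * (2 * ρ ^ (n + 1))) atTop (𝓝 0) := by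
    have hρ1 : ρ < 1 := lt_of_le_of_lt h.rho_le_half (by norm_num)
    have h1 : Tendsto (fun n => ρ ^ (n + 1)) atTop (𝓝 0) :=
      (ENNReal.tendsto_pow_atTop_nhds_zero_of_lt_one hρ1).comp (tendsto_add_atTop_nat 1)
    have h2 : Tendsto (fun n => 2 * ρ ^ (n + 1)) atTop (𝓝 (2 * 0)) :=
      ENNReal.Tendsto.const_mul h1 (Or.inr ENNReal.ofNat_ne_top)
    rw [mul_zero] at h2
    have h3 := ENNReal.Tendsto.const_mul h2 (Or.inr hC'top)
    rwa [mul_zero] at h3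
  rw [tendsto_iff_edist_tendsto_0]
  exact tendsto_of_tendsto_of_tendsto_of_le_of_le tendsto_const_nhds hlim (fun n => zero_le) hbound

/-- **The limit is a fixed point of the Duhamel map at every `(t, ξ)`**:
`v(t, ξ) = e^{-c‖ξ‖²τ} a(ξ) − D(v, v)(t, ξ)` (Leray 1934, §19/§26: the limit of the successive
approximations solves the integral equation). [folklore] -/
theorem fixed (h : RPicardHyp c m K T A AK a) (t : ℝ) (ξ : EuclideanSpace ℝ ι) :
    rpicardLimit c m T a t ξ = rduhamel c m T a (rpicardLimit c m T a) t ξ := by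
  have h1 : Tendsto (fun n => rpicardIter c m T a (n + 1) t ξ) atTop (𝓝 (rpicardLimit c m T a t ξ)) :=
    (h.tendsto_iter t ξ).comp (tendsto_add_atTop_nat 1)
  have h2 : Tendsto (fun n => rpicardIter c m T a (n + 1) t ξ) atTop (𝓝 (rduhamel c m T a (rpicardLimit c m T a) t ξ)) := by
    simp only [rpicardIter, rduhamel]
    exact tendsto_const_nhds.sub (h.tendsto_duhamelR_iter t ξ)
  exact tendsto_nhds_unique h1 h2


end RPicardHyp

/-! ### Transversality and conjugation symmetry -/

section Symmetry

variable {c T : ℝ} {m : (EuclideanSpace ℝ ι) → ℝ} {V W : ℝ → (EuclideanSpace ℝ ι) → ι → ℂ}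
  {J : ℕ} {A' B' : ℝ≥0∞}

/-- Components of the Duhamel term: `D(t,ξ)_l = ∫₀^τ e^{-c‖ξ‖²(τ-s)} N(s,ξ)_l ds`. [folklore] -/
theorem SliceBound.duhamelR_apply (h : SliceBound J A' B' V W) (hm : Measurable m) (hm1 : ∀ ξ, |m ξ| ≤ 1)
    (hc : 0 ≤ c) (T t : ℝ) (ξ : EuclideanSpace ℝ ι) (l : ι) :
    duhamelR c m T V W t ξ l =
      ∫ s in (0 : ℝ)..clamp T t, (heat c ξ (clamp T t - s) : ℂ) * nonlin (vmul m (V s)) (W s) ξ l := by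
  have hi := h.intervalIntegrable_integrand hm hm1 hc (clamp_nonneg T t) ξ (c := c)
  have hproj := ((ContinuousLinearMap.proj (R := ℝ) (φ := fun _ : ι => ℂ) l).intervalIntegral_comp_comm hi)
  simp only [ContinuousLinearMap.proj_apply, Pi.smul_apply, Complex.real_smul] at hproj
  rw [duhamelR, ← hproj]

/-- **The Duhamel term is transversal**: `∑ₗ ξₗ D(V, W)(t, ξ)_l = 0` for all `V`, `W`
(`∑ₗ ξₗ N_l = 0`, `sum_mul_nonlin`, and linearity of the time integral). [folklore] -/
theorem SliceBound.sum_mul_duhamelR (h : SliceBound J A' B' V W) (hm : Measurable m) (hm1 : ∀ ξ, |m ξ| ≤ 1)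
    (hc : 0 ≤ c) (T t : ℝ) (ξ : EuclideanSpace ℝ ι) : ∑ l, (ξ l : ℂ) * duhamelR c m T V W t ξ l = 0 := by
  set τ := clamp T t with hτ
  have hii : ∀ l, IntervalIntegrable (fun s => (ξ l : ℂ) * ((heat c ξ (τ - s) : ℂ) *
      nonlin (vmul m (V s)) (W s) ξ l)) volume 0 τ := fun l => by
    have hi := (h.intervalIntegrable_integrand hm hm1 hc (clamp_nonneg T t) ξ (c := c))
    have hil : IntervalIntegrable (fun s => (heat c ξ (τ - s) • nonlin (vmul m (V s)) (W s) ξ) l) volume 0 τ :=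
      ⟨(ContinuousLinearMap.proj (R := ℝ) (φ := fun _ : ι => ℂ) l).integrable_comp hi.1,
        (ContinuousLinearMap.proj (R := ℝ) (φ := fun _ : ι => ℂ) l).integrable_comp hi.2⟩
    refine (hil.const_mul (ξ l : ℂ)).congr fun s _ => ?_
    simp [Complex.real_smul]
  have hz : ∀ s, ∑ l, (ξ l : ℂ) * ((heat c ξ (τ - s) : ℂ) * nonlin (vmul m (V s)) (W s) ξ l) = 0 := fun s => by
    calc ∑ l, (ξ l : ℂ) * ((heat c ξ (τ - s) : ℂ) * nonlin (vmul m (V s)) (W s) ξ l)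
        = (heat c ξ (τ - s) : ℂ) * ∑ l, (ξ l : ℂ) * nonlin (vmul m (V s)) (W s) ξ l := by
          rw [Finset.mul_sum]; congr 1 with l; ring
      _ = 0 := by rw [sum_mul_nonlin, mul_zero]
  simp_rw [h.duhamelR_apply hm hm1 hc T t ξ, ← hτ, ← intervalIntegral.integral_const_mul]
  rw [← intervalIntegral.integral_finsetSum fun l _ => hii l]
  have : (fun s => ∑ l, (ξ l : ℂ) * ((heat c ξ (τ - s) : ℂ) * nonlin (vmul m (V s)) (W s) ξ l)) =
      fun _ => (0 : ℂ) := funext hz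
  rw [this, intervalIntegral.integral_zero]

omit [Fintype ι] [DecidableEq ι] in
/-- `vmul m V` inherits conjugation symmetry from `V` when `m` is real and even. [folklore] -/
theorem vmul_conj_symm {U : (EuclideanSpace ℝ ι) → ι → ℂ} (hme : ∀ ξ, m (-ξ) = m ξ)
    (hU : ∀ ξ j, U (-ξ) j = conj (U ξ j)) (ξ : EuclideanSpace ℝ ι) (j : ι) :
    vmul m U (-ξ) j = conj (vmul m U ξ j) := by
  simp only [vmul_apply, map_mul, Complex.conj_ofReal, hme, hU]

/-- **Conjugation symmetry of the Duhamel term**: if `V(s, -ξ) = conj V(s, ξ)` and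
`W(s, -ξ) = conj W(s, ξ)` componentwise and `m` is even, then `D(t, -ξ) = conj D(t, ξ)` (the heat
factor is real and even; `nonlin_conj_symm`; `intervalIntegral_conj`). [folklore] -/
theorem SliceBound.duhamelR_conj_symm (h : SliceBound J A' B' V W) (hm : Measurable m) (hm1 : ∀ ξ, |m ξ| ≤ 1)
    (hme : ∀ ξ, m (-ξ) = m ξ) (hc : 0 ≤ c) (hV : ∀ s ξ j, V s (-ξ) j = conj (V s ξ j))
    (hW : ∀ s ξ j, W s (-ξ) j = conj (W s ξ j)) (T t : ℝ) (ξ : EuclideanSpace ℝ ι) (l : ι) :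
    duhamelR c m T V W t (-ξ) l = conj (duhamelR c m T V W t ξ l) := by
  rw [h.duhamelR_apply hm hm1 hc T t (-ξ) l, h.duhamelR_apply hm hm1 hc T t ξ l,
    ← intervalIntegral.intervalIntegral_conj]
  congr 1 with s
  rw [map_mul, Complex.conj_ofReal, heat_neg, nonlin_conj_symm (vmul_conj_symm hme (hV s)) (hW s)]

end Symmetry

namespace RPicardHyp

variable {c T : ℝ} {m : (EuclideanSpace ℝ ι) → ℝ} {K : ℕ} {A AK : ℝ≥0∞} {a : (EuclideanSpace ℝ ι) → ι → ℂ}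

/-- **The iterates are transversal** when the datum is: `∑ₗ ξₗ v_n(t,ξ)_l = 0`. [folklore] -/
theorem sum_mul_iter (h : RPicardHyp c m K T A AK a) (hdiv : ∀ ξ, ∑ l, (ξ l : ℂ) * a ξ l = 0) (n : ℕ) (t : ℝ)
    (ξ : EuclideanSpace ℝ ι) : ∑ l, (ξ l : ℂ) * rpicardIter c m T a n t ξ l = 0 := by
  have hheat : ∑ l, (ξ l : ℂ) * ((heat c ξ (clamp T t) : ℂ) * a ξ l) = 0 := by
    calc ∑ l, (ξ l : ℂ) * ((heat c ξ (clamp T t) : ℂ) * a ξ l)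
        = (heat c ξ (clamp T t) : ℂ) * ∑ l, (ξ l : ℂ) * a ξ l := by
          rw [Finset.mul_sum]; congr 1 with l; ring
      _ = 0 := by rw [hdiv, mul_zero]
  cases n with
  | zero => simpa [rpicardIter, Complex.real_smul] using hheat
  | succ n =>
    simp only [rpicardIter, rduhamel, Pi.sub_apply, Pi.smul_apply, Complex.real_smul, mul_sub,
      Finset.sum_sub_distrib]
    rw [hheat, (h.sliceBound_iter n).sum_mul_duhamelR h.hm.measurable h.hm.abs_le_one h.hc.le T t ξ, sub_zero]

/-- **The limit is transversal** when the datum is: `∑ₗ ξₗ v(t,ξ)_l = 0` (pass to the limit). [folklore] -/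
theorem sum_mul_limit (h : RPicardHyp c m K T A AK a) (hdiv : ∀ ξ, ∑ l, (ξ l : ℂ) * a ξ l = 0) (t : ℝ)
    (ξ : EuclideanSpace ℝ ι) : ∑ l, (ξ l : ℂ) * rpicardLimit c m T a t ξ l = 0 := by
  have h1 : Tendsto (fun n => ∑ l, (ξ l : ℂ) * rpicardIter c m T a n t ξ l) atTop
      (𝓝 (∑ l, (ξ l : ℂ) * rpicardLimit c m T a t ξ l)) :=
    tendsto_finsetSum _ fun l _ => ((continuous_apply l).continuousAt.tendsto.comp (h.tendsto_iter t ξ)).const_mul _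
  exact tendsto_nhds_unique h1 (by simp only [h.sum_mul_iter hdiv]; exact tendsto_const_nhds)

/-- **The iterates are conjugation symmetric** when the datum is:
`v_n(t,-ξ)_l = conj v_n(t,ξ)_l`. [folklore] -/
theorem iter_conj_symm (h : RPicardHyp c m K T A AK a) (ha : ∀ ξ l, a (-ξ) l = conj (a ξ l)) (n : ℕ) :
    ∀ t (ξ : EuclideanSpace ℝ ι) l, rpicardIter c m T a n t (-ξ) l = conj (rpicardIter c m T a n t ξ l) := by
  induction n with
  | zero =>
    intro t ξ l
    simp [rpicardIter, Complex.real_smul, heat_neg, ha]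
  | succ n ih =>
    intro t ξ l
    simp only [rpicardIter, rduhamel, Pi.sub_apply, Pi.smul_apply, Complex.real_smul, map_sub, map_mul,
      Complex.conj_ofReal, heat_neg, ha]
    rw [(h.sliceBound_iter n).duhamelR_conj_symm h.hm.measurable h.hm.abs_le_one h.hm.even h.hc.le ih ih T t ξ l]

/-- **The limit is conjugation symmetric** when the datum is: `v(t,-ξ)_l = conj v(t,ξ)_l`
(pass to the limit; `conj` is continuous). [folklore] -/
theorem limit_conj_symm (h : RPicardHyp c m K T A AK a) (ha : ∀ ξ l, a (-ξ) l = conj (a ξ l)) (t : ℝ)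
    (ξ : EuclideanSpace ℝ ι) (l : ι) : rpicardLimit c m T a t (-ξ) l = conj (rpicardLimit c m T a t ξ l) := by
  have h1 : Tendsto (fun n => rpicardIter c m T a n t (-ξ) l) atTop (𝓝 (rpicardLimit c m T a t (-ξ) l)) :=
    (continuous_apply l).continuousAt.tendsto.comp (h.tendsto_iter t (-ξ))
  have h2 : Tendsto (fun n => rpicardIter c m T a n t (-ξ) l) atTop (𝓝 (conj (rpicardLimit c m T a t ξ l))) := by
    simp only [h.iter_conj_symm ha]
    exact (Complex.continuous_conj.tendsto _).comp ((continuous_apply l).continuousAt.tendsto.comp (h.tendsto_iter t ξ))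
  exact tendsto_nhds_unique h1 h2

end RPicardHyp


/-! ### An explicit admissible time -/

section Time

variable {c : ℝ} {m : (EuclideanSpace ℝ ι) → ℝ} {K : ℕ} {A : ℝ≥0∞}

omit [DecidableEq ι] in
/-- **An admissible time** `T = (2Λ + 2)^{-2}`, `Λ = (C₀(c) κ_K 4A).toReal`, for which the
contraction condition `2ρ ≤ 1` holds (Leray 1934, §26: the existence time of the regularised
problem is bounded below in terms of `W(0) = ‖u(0)‖₂` only). [folklore] -/
def rpicardTime (c : ℝ) (m : (EuclideanSpace ℝ ι) → ℝ) (K : ℕ) (A : ℝ≥0∞) : ℝ :=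
  ((2 * (C₀ c * kap m K * (4 * A)).toReal + 2)⁻¹) ^ 2

omit [DecidableEq ι] in
/-- `rpicardTime > 0`. [folklore] -/
theorem rpicardTime_pos (c : ℝ) (m : (EuclideanSpace ℝ ι) → ℝ) (K : ℕ) (A : ℝ≥0∞) : 0 < rpicardTime c m K A := by
  unfold rpicardTime; positivity

omit [DecidableEq ι] in
/-- **The contraction condition holds at `rpicardTime`**: `2 ρ(T) ≤ 1` as soon as
`C₀ κ_K 4A < ∞` (i.e. `κ_K, A < ∞`). [folklore] -/
theorem two_mul_rho_rpicardTime_le (hX : C₀ c * kap m K * (4 * A) ≠ ∞) :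
    2 * rho c m K (rpicardTime c m K A) A ≤ 1 := by
  set Λ : ℝ := (C₀ c * kap m K * (4 * A)).toReal with hΛ
  have hΛ0 : 0 ≤ Λ := ENNReal.toReal_nonneg
  have hX' : C₀ c * kap m K * (4 * A) = ENNReal.ofReal Λ := (ENNReal.ofReal_toReal hX).symm
  have hden : 0 < 2 * Λ + 2 := by positivity
  have hT : ENNReal.ofReal (rpicardTime c m K A) ^ (1 / 2 : ℝ) = ENNReal.ofReal ((2 * Λ + 2)⁻¹) := by
    rw [rpicardTime, ← hΛ, ENNReal.ofReal_pow (by positivity), sq_rpow_half]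
  have hrho : rho c m K (rpicardTime c m K A) A = ENNReal.ofReal Λ * ENNReal.ofReal ((2 * Λ + 2)⁻¹) := by
    rw [rho, hT, ← hX']; ring
  rw [hrho, ← ENNReal.ofReal_mul hΛ0, ← ENNReal.ofReal_ofNat, ← ENNReal.ofReal_mul (by norm_num),
    ← ENNReal.ofReal_one]
  refine ENNReal.ofReal_le_ofReal ?_
  rw [show (2 : ℝ) * (Λ * (2 * Λ + 2)⁻¹) = 2 * Λ / (2 * Λ + 2) by ring, div_le_one hden]
  linarith

omit [DecidableEq ι] in
/-- Finiteness of `C₀ κ_K 4A` for a mollifier symbol and `A < ∞`. [folklore] -/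
theorem IsMollifierSymbol.C₀_kap_A_ne_top (hm : IsMollifierSymbol m) (c : ℝ) (K : ℕ) (hA : A ≠ ∞) :
    C₀ c * kap m K * (4 * A) ≠ ∞ :=
  ENNReal.mul_ne_top (ENNReal.mul_ne_top (C₀_ne_top c) (hm.kap_ne_top K)) (ENNReal.mul_ne_top ENNReal.ofNat_ne_top hA)

omit [DecidableEq ι] in
/-- **The hypotheses of the scheme hold at `rpicardTime`** for every measurable datum with
`‖a‖_{L²} ≤ A < ∞`, `‖wfun K a‖_{L²} ≤ AK < ∞`. [folklore] -/
theorem RPicardHyp.of_rpicardTime (hc : 0 < c) (hm : IsMollifierSymbol m) {AK : ℝ≥0∞}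
    {a : (EuclideanSpace ℝ ι) → ι → ℂ} (ha : Measurable a) (hA : eLpNorm a 2 volume ≤ A)
    (hAK : eLpNorm (wfun K a) 2 volume ≤ AK) (hAt : A ≠ ∞) (hAKt : AK ≠ ∞) :
    RPicardHyp c m K (rpicardTime c m K A) A AK a where
  hc := hc
  hm := hm
  hT := rpicardTime_pos c m K A
  meas := ha
  boundA := hA
  boundK := hAK
  A_ne_top := hAt
  AK_ne_top := hAKt
  contract := two_mul_rho_rpicardTime_le (hm.C₀_kap_A_ne_top c K hAt)

end Time

/-! ### `L²` continuity in time of the limit -/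

namespace RPicardHyp

variable {c T : ℝ} {m : (EuclideanSpace ℝ ι) → ℝ} {K : ℕ} {A AK : ℝ≥0∞} {a : (EuclideanSpace ℝ ι) → ι → ℂ}

/-- **Pointwise domination of the limit**: `‖v(t, ξ)‖ₑ ≤ ‖a ξ‖ₑ + C_D (1+‖ξ‖)^{-K}` with a finite
constant `C_D` (the heat part is bounded by the datum, the Duhamel part has pointwise decay of
order `K`). [folklore] -/
theorem exists_enorm_limit_le (h : RPicardHyp c m K T A AK a) :
    ∃ C : ℝ≥0∞, C ≠ ∞ ∧ ∀ t (ξ : EuclideanSpace ℝ ι),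
      ‖rpicardLimit c m T a t ξ‖ₑ ≤ ‖a ξ‖ₑ + C * (ENNReal.ofReal ((1 + ‖ξ‖) ^ K))⁻¹ := by
  obtain ⟨M, -, hM⟩ := h.hm.decay' K
  set C : ℝ≥0∞ := ENNReal.ofReal (4 * π) * ENNReal.ofReal (1 / (2 * c)) ^ (1 / 2 : ℝ) * ENNReal.ofReal T ^ (1 / 2 : ℝ) *
    ((Fintype.card ι : ℝ≥0∞) ^ 2 * (ENNReal.ofReal M * (2 * A) * (2 * AK))) with hC
  have hCtop : C ≠ ∞ := by
    refine ENNReal.mul_ne_top (ENNReal.mul_ne_top (ENNReal.mul_ne_top ENNReal.ofReal_ne_top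
      (ENNReal.rpow_ne_top_of_nonneg (by norm_num) ENNReal.ofReal_ne_top))
      (ENNReal.rpow_ne_top_of_nonneg (by norm_num) ENNReal.ofReal_ne_top)) ?_
    exact ENNReal.mul_ne_top (ENNReal.pow_ne_top (ENNReal.natCast_ne_top _)) (ENNReal.mul_ne_top
      (ENNReal.mul_ne_top ENNReal.ofReal_ne_top (ENNReal.mul_ne_top ENNReal.ofNat_ne_top h.A_ne_top))
      (ENNReal.mul_ne_top ENNReal.ofNat_ne_top h.AK_ne_top))
  refine ⟨C, hCtop, fun t ξ => ?_⟩
  have hw0 : ENNReal.ofReal ((1 + ‖ξ‖) ^ K) ≠ 0 := by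
    rw [ne_eq, ENNReal.ofReal_eq_zero, not_le]; positivity
  have hD : ‖duhamelR c m T (rpicardLimit c m T a) (rpicardLimit c m T a) t ξ‖ₑ ≤
      C * (ENNReal.ofReal ((1 + ‖ξ‖) ^ K))⁻¹ := by
    have h1 := h.sliceBound_limit.weight_mul_enorm_duhamelR_le h.hm.measurable h.hc h.hT.le hM t ξ
    rw [← hC] at h1
    calc ‖duhamelR c m T (rpicardLimit c m T a) (rpicardLimit c m T a) t ξ‖ₑ
        = (ENNReal.ofReal ((1 + ‖ξ‖) ^ K))⁻¹ * (ENNReal.ofReal ((1 + ‖ξ‖) ^ K) *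
            ‖duhamelR c m T (rpicardLimit c m T a) (rpicardLimit c m T a) t ξ‖ₑ) := by
          rw [← mul_assoc, ENNReal.inv_mul_cancel hw0 ENNReal.ofReal_ne_top, one_mul]
      _ ≤ (ENNReal.ofReal ((1 + ‖ξ‖) ^ K))⁻¹ * C := mul_le_mul_right h1 _
      _ = C * (ENNReal.ofReal ((1 + ‖ξ‖) ^ K))⁻¹ := mul_comm _ _
  rw [h.fixed t ξ, rduhamel]
  refine (enorm_sub_le).trans (add_le_add ?_ hD)
  rw [enorm_smul, Real.enorm_eq_ofReal (heat_nonneg c ξ _)]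
  calc ENNReal.ofReal (heat c ξ (clamp T t)) * ‖a ξ‖ₑ ≤ 1 * ‖a ξ‖ₑ :=
        mul_le_mul_left (ENNReal.ofReal_le_one.2 (heat_le_one h.hc.le (clamp_nonneg T t) ξ)) _
    _ = ‖a ξ‖ₑ := one_mul _

omit [Fintype ι] [DecidableEq ι] in
/-- `(x + y)² ≤ 4 (x² + y²)` in `ℝ≥0∞` (crude; twin of `ENNReal.add_sq_le_four_mul` in
`SolenoidalTruncation`, restated in three lines rather than importing the torus truncation file). [folklore] -/
theorem sq_add_le_four_mul (x y : ℝ≥0∞) : (x + y) ^ 2 ≤ 4 * (x ^ 2 + y ^ 2) := by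
  rcases le_total x y with hxy | hxy
  · calc (x + y) ^ 2 ≤ (y + y) ^ 2 := by gcongr
      _ = 4 * y ^ 2 := by ring
      _ ≤ 4 * (x ^ 2 + y ^ 2) := by gcongr; exact le_add_self
  · calc (x + y) ^ 2 ≤ (x + x) ^ 2 := by gcongr
      _ = 4 * x ^ 2 := by ring
      _ ≤ 4 * (x ^ 2 + y ^ 2) := by gcongr; exact le_self_add

/-- **The limit is continuous in time into `L²`** when `2K > card ι`: `‖v(t) − v(t₀)‖_{L²} → 0`
as `t → t₀` (pointwise continuity in `t` and the domination `‖v(t,ξ)‖ ≤ ‖a ξ‖ + C(1+‖ξ‖)^{-K} ∈ L²`;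
dominated convergence). [folklore] -/
theorem tendsto_eLpNorm_limit_sub (h : RPicardHyp c m K T A AK a) (hK : Fintype.card ι < 2 * K) (t₀ : ℝ) :
    Tendsto (fun t => eLpNorm (rpicardLimit c m T a t - rpicardLimit c m T a t₀) 2 volume) (𝓝 t₀) (𝓝 0) := by
  obtain ⟨C, hCtop, hdom⟩ := h.exists_enorm_limit_le
  set v := rpicardLimit c m T a with hv
  set w : (EuclideanSpace ℝ ι) → ℝ≥0∞ := fun ξ => (ENNReal.ofReal ((1 + ‖ξ‖) ^ K))⁻¹ with hw
  set B : (EuclideanSpace ℝ ι) → ℝ≥0∞ := fun ξ => 32 * (‖a ξ‖ₑ ^ 2 + C ^ 2 * w ξ ^ 2) with hB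
  -- integrability of the bound
  have ha2 : ∫⁻ ξ, ‖a ξ‖ₑ ^ 2 ∂(volume : Measure (EuclideanSpace ℝ ι)) ≠ ∞ := by
    rw [lintegral_enorm_sq_eq_eLpNorm_sq]
    exact ENNReal.pow_ne_top (ne_top_of_le_ne_top h.A_ne_top h.boundA)
  have hw2 : ∫⁻ ξ, w ξ ^ 2 ∂(volume : Measure (EuclideanSpace ℝ ι)) ≠ ∞ := by
    have hint : Integrable (fun ξ : EuclideanSpace ℝ ι => ((1 + ‖ξ‖) ^ (2 * K))⁻¹) volume :=
      integrable_inv_one_add_norm_pow (by simpa using hK)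
    refine ne_top_of_le_ne_top hint.hasFiniteIntegral.ne (le_of_eq (lintegral_congr fun ξ => ?_))
    have hpos : 0 < (1 + ‖ξ‖) ^ K := by positivity
    simp only [hw]
    rw [← ENNReal.ofReal_inv_of_pos hpos, ← ENNReal.ofReal_pow (by positivity),
      Real.enorm_eq_ofReal (by positivity)]
    congr 1
    rw [inv_pow, ← pow_mul, mul_comm K 2]
  have hBint : ∫⁻ ξ, B ξ ≠ ∞ := by
    simp only [hB]
    rw [lintegral_const_mul' _ _ ENNReal.ofNat_ne_top, lintegral_add_left ((h.meas.enorm.pow_const 2)),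
      lintegral_const_mul' _ _ (ENNReal.pow_ne_top hCtop)]
    exact ENNReal.mul_ne_top ENNReal.ofNat_ne_top (ENNReal.add_ne_top.2 ⟨ha2, ENNReal.mul_ne_top (ENNReal.pow_ne_top hCtop) hw2⟩)
  -- domination of the squared difference
  have hle : ∀ t ξ, ‖v t ξ - v t₀ ξ‖ₑ ^ 2 ≤ B ξ := by
    intro t ξ
    have hG : ∀ s, ‖v s ξ‖ₑ ≤ ‖a ξ‖ₑ + C * w ξ := fun s => hdom s ξ
    calc ‖v t ξ - v t₀ ξ‖ₑ ^ 2 ≤ (‖v t ξ‖ₑ + ‖v t₀ ξ‖ₑ) ^ 2 := by gcongr; exact enorm_sub_le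
      _ ≤ ((‖a ξ‖ₑ + C * w ξ) + (‖a ξ‖ₑ + C * w ξ)) ^ 2 := by gcongr <;> exact hG _
      _ ≤ 4 * ((‖a ξ‖ₑ + C * w ξ) ^ 2 + (‖a ξ‖ₑ + C * w ξ) ^ 2) := sq_add_le_four_mul _ _
      _ ≤ 4 * (4 * (‖a ξ‖ₑ ^ 2 + (C * w ξ) ^ 2) + 4 * (‖a ξ‖ₑ ^ 2 + (C * w ξ) ^ 2)) := by
          gcongr <;> exact sq_add_le_four_mul _ _
      _ = B ξ := by simp only [hB, mul_pow]; ring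
  -- dominated convergence for `∫⁻ ‖v t − v t₀‖ₑ²`
  have hmeas : ∀ t, Measurable fun ξ => ‖v t ξ - v t₀ ξ‖ₑ ^ 2 := fun t =>
    ((h.measurable_limit_slice t).sub (h.measurable_limit_slice t₀)).enorm.pow_const 2
  have hpt : ∀ ξ, Tendsto (fun t => ‖v t ξ - v t₀ ξ‖ₑ ^ 2) (𝓝 t₀) (𝓝 0) := by
    intro ξ
    have h1 : Tendsto (fun t => v t ξ - v t₀ ξ) (𝓝 t₀) (𝓝 (v t₀ ξ - v t₀ ξ)) :=
      ((h.continuous_limit_time ξ).tendsto t₀).sub_const _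
    rw [sub_self] at h1
    have h2 : Tendsto (fun t => ‖v t ξ - v t₀ ξ‖ₑ ^ 2) (𝓝 t₀) (𝓝 (‖(0 : ι → ℂ)‖ₑ ^ 2)) :=
      ((ENNReal.continuous_pow 2).tendsto _).comp ((continuous_enorm.tendsto _).comp h1)
    simpa using h2
  have hDC := tendsto_lintegral_filter_of_dominated_convergence B (Eventually.of_forall hmeas)
    (Eventually.of_forall fun t => Eventually.of_forall fun ξ => hle t ξ) hBint (Eventually.of_forall hpt)
  simp only [lintegral_zero] at hDC
  -- `eLpNorm = (∫⁻ ‖·‖ₑ²)^{1/2}`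
  have heq : ∀ t, eLpNorm (v t - v t₀) 2 volume = (∫⁻ ξ, ‖v t ξ - v t₀ ξ‖ₑ ^ 2) ^ (1 / 2 : ℝ) := by
    intro t
    rw [← sq_rpow_half (eLpNorm (v t - v t₀) 2 volume), ← lintegral_enorm_sq_eq_eLpNorm_sq]
    rfl
  simp_rw [heq]
  have h0 : (0 : ℝ≥0∞) = 0 ^ (1 / 2 : ℝ) := by rw [ENNReal.zero_rpow_of_pos (by norm_num)]
  rw [h0]
  exact (ENNReal.continuous_rpow_const.tendsto 0).comp hDC

end RPicardHyp


end Literature.Analysis.FluidPDE.FourierNS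

end
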